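import Mathlib.AlgebraicGeometry.EllipticCurve.DivisionPolynomial.Basic
import Literature.NumberTheory.EllipticCurves.GoodReductionInertia
import HarnessLib

/-!
# From rational `2`- and `4`-torsion to the Legendre form, and its reduction at `p ≠ 2`

Topic `NumberTheory/EllipticCurves`. Elementary algebra behind Silverman, *AEC*, Prop. III.1.7
(Legendre form: over a field with `2 ≠ 0`, an elliptic curve with rational `2`-torsion
`(e₁, 0), (e₂, 0), (e₃, 0)` is `y² = x(x - A)(x - B)` after `x ↦ x + e₁`, and becomes
`y² = x(x - 1)(x - λ)` after rescaling by `u = √A`) and the case analysis of the proof of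
Prop. VII.5.4(c) / VII.5.5 (PDF pp. 176–177: `y² = x(x-1)(x-λ)` has good reduction if
`λ ≢ 0, 1`, and `|j| > 1` otherwise), arranged for the criterion of Néron–Ogg–Shafarevich at a
place of residue characteristic `≠ 2` (`UnramifiedFourTorsionGoodReduction`): the square root
`√A = √(e₂ - e₁)` is supplied *rationally* by a `4`-torsion point halving `(e₂, 0)`
(`sq_eq_of_add_self_eq`: if `2Q = (A, 0)` on `y² = x(x - A)(x - B)` then
`A = (x(Q)(x(Q) - A)/y(Q))²`, Silverman, *AEC*, X.1 Prop. 1.4 / Knapp Thm. 4.2: `(A, 0) ∈ 2E(F)`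
iff `A` and `A - B` are squares), so that all changes of variables have coordinates in the field
generated by the `4`-torsion.

Contents (theorems only; the curves are literal Weierstrass equations, as in
`NeronModelProofs`):

* `smul_eq_of_isRoot_Ψ₂Sq`: for `W` with `2 ≠ 0` and three distinct roots `e₁, e₂, e₃` of the
  `2`-division polynomial `Ψ₂Sq = 4X³ + b₂X² + 2b₄X + b₆` (the abscissae of the points of order
  `2`), the change of variables `⟨1, e₁, -a₁/2, -(a₁e₁ + a₃)/2⟩` gives
  `y² = x(x - A)(x - B) = ⟨0, -(A + B), 0, AB, 0⟩`, `A = e₂ - e₁`, `B = e₃ - e₁` (Vieta);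
* `sq_eq_of_add_self_eq` (halving): `Q + Q = (A, 0)` on `y² = x(x - A)(x - B)` forces
  `x(Q) ≠ A`, `y(Q) ≠ 0` and `A = (x(Q)(x(Q) - A)/y(Q))²`;
* `smul_eq_legendre`: rescaling `y² = x(x - α²)(x - B)` by `u = α` gives the Legendre equation
  `⟨0, -(1 + λ), 0, λ, 0⟩`, `λ = B/α²`;
* `legendre_Δ`, `legendre_c₄` (`Δ = 16λ²(λ - 1)²`, `c₄ = 16(λ² - λ + 1)`), and over a valued field
  `(L, w)` with `|2| = 1`: `isIntegral_legendre_of_val` (`|λ| = |λ - 1| = 1` ⟹ integral with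
  `|Δ| = 1`) and `one_lt_val_j_legendre` (otherwise `|j| > 1`) — the dichotomy "good reduction or
  `|j| > 1`" of *AEC* VII.5.4(c)/VII.5.5 for Legendre equations.

## References

* [SilvermanAEC2009] J. H. Silverman, *The Arithmetic of Elliptic Curves*, 2nd ed., GTM 106,
  Springer 2009: Prop. III.1.7 and proof (PDF pp. 53–54), proof of Prop. VII.5.4(c) and of
  Prop. VII.5.5 (PDF pp. 176–177), X.1 Prop. 1.4 (halving and squares), III.2.3 (group law).
-/

noncomputable section

open scoped NNReal

universe u

namespace Literature.NumberTheory.EllipticCurves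

open _root_.WeierstrassCurve _root_.Polynomial

/-! ## From three rational points of order `2` to `y² = x(x - A)(x - B)` -/

section TwoTorsion

variable {F : Type u} [Field F]

/-- Evaluation of the `2`-division polynomial: `Ψ₂Sq(e) = 4e³ + b₂e² + 2b₄e + b₆`. [folklore] -/
theorem eval_Ψ₂Sq (W : WeierstrassCurve F) (e : F) :
    W.Ψ₂Sq.eval e = 4 * e ^ 3 + W.b₂ * e ^ 2 + 2 * W.b₄ * e + W.b₆ := by
  simp only [Ψ₂Sq, eval_add, eval_mul, eval_C, eval_pow, eval_X]

/-- **Vieta for the `2`-division cubic and the form `y² = x(x - A)(x - B)`** (Silverman, *AEC*,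
proof of Prop. III.1.7). If `2 ≠ 0` in `F` and `e₁, e₂, e₃` are three distinct roots of
`Ψ₂Sq = 4X³ + b₂X² + 2b₄X + b₆`, then `b₂ = -4(e₁ + e₂ + e₃)`, `b₄ = 2(e₁e₂ + e₁e₃ + e₂e₃)` and the
change of variables `x = x' + e₁`, `y = y' - (a₁/2)x' - (a₁e₁ + a₃)/2` (completing the square and
translating `(e₁, 0)` to the origin) carries `W` to `y² = x(x - A)(x - B)` with `A = e₂ - e₁`,
`B = e₃ - e₁`. [cite: SilvermanAEC2009, Prop. III.1.7 (proof)] -/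
theorem smul_eq_of_isRoot_Ψ₂Sq (W : WeierstrassCurve F) (h2 : (2 : F) ≠ 0) {e₁ e₂ e₃ s t : F}
    (he₁ : W.Ψ₂Sq.IsRoot e₁) (he₂ : W.Ψ₂Sq.IsRoot e₂) (he₃ : W.Ψ₂Sq.IsRoot e₃)
    (h12 : e₁ ≠ e₂) (h13 : e₁ ≠ e₃) (h23 : e₂ ≠ e₃) (hs : 2 * s + W.a₁ = 0)
    (ht : 2 * t + W.a₁ * e₁ + W.a₃ = 0) :
    (⟨1, e₁, s, t⟩ : VariableChange F) • W =
      ⟨0, -((e₂ - e₁) + (e₃ - e₁)), 0, (e₂ - e₁) * (e₃ - e₁), 0⟩ := by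
  rw [IsRoot, eval_Ψ₂Sq] at he₁ he₂ he₃
  have h4 : (4 : F) ≠ 0 := by
    have := mul_ne_zero h2 h2; norm_num at this; exact this
  -- Vieta: `b₂ = -4σ₁`, `b₄ = 2σ₂`, `b₆ = -4σ₃`
  have q12 : (e₁ - e₂) * (4 * (e₁ ^ 2 + e₁ * e₂ + e₂ ^ 2) + W.b₂ * (e₁ + e₂) + 2 * W.b₄) = 0 := by
    linear_combination he₁ - he₂
  have q13 : (e₁ - e₃) * (4 * (e₁ ^ 2 + e₁ * e₃ + e₃ ^ 2) + W.b₂ * (e₁ + e₃) + 2 * W.b₄) = 0 := by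
    linear_combination he₁ - he₃
  have q12' := (mul_eq_zero.mp q12).resolve_left (sub_ne_zero.mpr h12)
  have q13' := (mul_eq_zero.mp q13).resolve_left (sub_ne_zero.mpr h13)
  have qb₂ : (e₂ - e₃) * (4 * (e₁ + e₂ + e₃) + W.b₂) = 0 := by linear_combination q12' - q13'
  have hb₂ : W.b₂ = -4 * (e₁ + e₂ + e₃) := by
    linear_combination (mul_eq_zero.mp qb₂).resolve_left (sub_ne_zero.mpr h23)
  have hb₄ : W.b₄ = 2 * (e₁ * e₂ + e₁ * e₃ + e₂ * e₃) := by
    refine mul_left_cancel₀ h2 ?_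
    linear_combination q12' - (e₁ + e₂) * hb₂
  have hb₆ : W.b₆ = -4 * (e₁ * e₂ * e₃) := by
    linear_combination he₁ - e₁ ^ 2 * hb₂ - 2 * e₁ * hb₄
  -- in terms of `a₁, …, a₆` and `s, t` (`a₁ = -2s`, `a₃ = 2(s e₁ - t)`)
  have ha₁ : W.a₁ = -2 * s := by linear_combination hs
  have ha₃ : W.a₃ = 2 * (s * e₁ - t) := by linear_combination ht - e₁ * hs
  have hσ₁ : W.a₂ + s ^ 2 = -(e₁ + e₂ + e₃) := by
    refine mul_left_cancel₀ h4 ?_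
    have : W.a₁ ^ 2 + 4 * W.a₂ = W.b₂ := by simp only [b₂]
    linear_combination this + hb₂ - (W.a₁ - 2 * s) * ha₁
  have hσ₂ : W.a₄ = (e₁ * e₂ + e₁ * e₃ + e₂ * e₃) + 2 * s * (s * e₁ - t) := by
    refine mul_left_cancel₀ h2 ?_
    have : 2 * W.a₄ + W.a₁ * W.a₃ = W.b₄ := by simp only [b₄]
    linear_combination this + hb₄ - W.a₃ * ha₁ + 2 * s * ha₃
  have hσ₃ : W.a₆ = -(e₁ * e₂ * e₃) - (s * e₁ - t) ^ 2 := by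
    refine mul_left_cancel₀ h4 ?_
    have : W.a₃ ^ 2 + 4 * W.a₆ = W.b₆ := by simp only [b₆]
    linear_combination this + hb₆ - (W.a₃ + 2 * (s * e₁ - t)) * ha₃
  ext
  · simp only [variableChange_a₁, Units.val_one, inv_one, one_mul]
    linear_combination hs
  · simp only [variableChange_a₂, Units.val_one, inv_one, one_pow, one_mul]
    linear_combination hσ₁ - s * ha₁
  · simp only [variableChange_a₃, Units.val_one, inv_one, one_pow, one_mul]
    linear_combination ha₃ + e₁ * ha₁
  · simp only [variableChange_a₄, Units.val_one, inv_one, one_pow, one_mul]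
    linear_combination hσ₂ - s * ha₃ + 2 * e₁ * hσ₁ - (t + e₁ * s) * ha₁
  · simp only [variableChange_a₆, Units.val_one, inv_one, one_pow, one_mul]
    linear_combination hσ₃ + e₁ * hσ₂ + e₁ ^ 2 * hσ₁ - t * ha₃ - e₁ * t * ha₁

end TwoTorsion

/-! ## Halving a point of order `2` on `y² = x(x - A)(x - B)` -/

section Halving

variable {F : Type u} [Field F] [DecidableEq F]

/-- **Halving and squares** (Silverman, *AEC*, X.1 Prop. 1.4; Knapp, *Elliptic Curves*,
Thm. 4.2: on `y² = (x - e₁)(x - e₂)(x - e₃)`, a point `(e₂, 0)` lies in `2E(F)` iff `e₂ - e₁` and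
`e₂ - e₃` are squares in `F`). Explicit form used here: on `y² = x(x - A)(x - B)` over a field with
`2 ≠ 0`, if `Q = (x₀, y₀)` satisfies `Q + Q = (A, 0)` then `x₀ ≠ A`, `y₀ ≠ 0` and
`A = (x₀(x₀ - A)/y₀)²` — the tangent at `Q` passes through `(A, 0)`, so its slope is
`λ = y₀/(x₀ - A)`, and `x(2Q) = λ² + A + B - 2x₀ = A` with the curve equation gives `x₀² = Aλ²`.
[cite: SilvermanAEC2009, X.1 Prop. 1.4] -/
theorem sq_eq_of_add_self_eq (h2 : (2 : F) ≠ 0) {A B x₀ y₀ : F}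
    (hQ : (⟨0, -(A + B), 0, A * B, 0⟩ : WeierstrassCurve F).toAffine.Nonsingular x₀ y₀)
    (hT : (⟨0, -(A + B), 0, A * B, 0⟩ : WeierstrassCurve F).toAffine.Nonsingular A 0)
    (h : Affine.Point.some x₀ y₀ hQ + Affine.Point.some x₀ y₀ hQ = Affine.Point.some A 0 hT) :
    x₀ ≠ A ∧ y₀ ≠ 0 ∧ A = (x₀ * (x₀ - A) / y₀) ^ 2 := by
  have heq : y₀ ^ 2 = x₀ * (x₀ - A) * (x₀ - B) := by
    have := (Affine.equation_iff x₀ y₀).mp hQ.1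
    simp only at this
    linear_combination this
  have hnegY : (⟨0, -(A + B), 0, A * B, 0⟩ : WeierstrassCurve F).toAffine.negY x₀ y₀ = -y₀ := by
    simp [Affine.negY]
  have hy0 : y₀ ≠ 0 := by
    intro hy
    have hneg : y₀ = (⟨0, -(A + B), 0, A * B, 0⟩ : WeierstrassCurve F).toAffine.negY x₀ y₀ := by
      rw [hnegY, hy, neg_zero]
    rw [Affine.Point.add_self_of_Y_eq hneg] at h
    exact Affine.Point.some_ne_zero hT h.symm
  have hyne : y₀ ≠ (⟨0, -(A + B), 0, A * B, 0⟩ : WeierstrassCurve F).toAffine.negY x₀ y₀ := by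
    rw [hnegY]
    intro h'
    apply hy0
    have : (2 : F) * y₀ = 0 := by linear_combination h'
    exact (mul_eq_zero.mp this).resolve_left h2
  rw [Affine.Point.add_self_of_Y_ne hyne, Affine.Point.some.injEq] at h
  obtain ⟨hX, hY⟩ := h
  set L := (⟨0, -(A + B), 0, A * B, 0⟩ : WeierstrassCurve F).toAffine.slope x₀ x₀ y₀ y₀ with hL
  rw [Affine.addY, Affine.negAddY, hX] at hY
  simp only [Affine.negY, Affine.addX] at hX hY
  have hL2 : L ^ 2 = 2 * x₀ - B := by linear_combination hX
  have hyL : y₀ = L * (x₀ - A) := by linear_combination -hY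
  have hxA : x₀ ≠ A := by
    intro hx
    apply hy0
    rw [hyL, hx, sub_self, mul_zero]
  have e0 : L ^ 2 * (x₀ - A) ^ 2 = x₀ * (x₀ - A) * (x₀ - B) := by rw [← heq, hyL]; ring
  have key : (x₀ - A) * (x₀ ^ 2 - A * L ^ 2) = 0 := by
    linear_combination e0 - (x₀ - A) * x₀ * hL2
  have hx2 : x₀ ^ 2 = A * L ^ 2 := by
    have := (mul_eq_zero.mp key).resolve_left (sub_ne_zero.mpr hxA)
    linear_combination this
  refine ⟨hxA, hy0, ?_⟩
  rw [div_pow, eq_div_iff (pow_ne_zero 2 hy0)]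
  linear_combination (-(x₀ - A) ^ 2) * hx2 + (A * (y₀ + L * (x₀ - A))) * hyL

end Halving

/-! ## The Legendre equation: rescaling, invariants, and reduction at `|2| = 1` -/

section Legendre

variable {F : Type u} [Field F]

/-- Rescaling `y² = x(x - α²)(x - B)` by `u = α` gives the Legendre equation
`y² = x(x - 1)(x - λ) = ⟨0, -(1 + λ), 0, λ, 0⟩` with `λ = B/α²` (Silverman, *AEC*, proof of
Prop. III.1.7: `x = (e₂ - e₁)x'`, `y = (e₂ - e₁)^{3/2}y'`).
[cite: SilvermanAEC2009, Prop. III.1.7 (proof)] -/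
theorem smul_sq_eq_legendre {α B : F} (hα : α ≠ 0) :
    (⟨Units.mk0 α hα, 0, 0, 0⟩ : VariableChange F) •
        (⟨0, -(α ^ 2 + B), 0, α ^ 2 * B, 0⟩ : WeierstrassCurve F) =
      ⟨0, -(1 + B / α ^ 2), 0, B / α ^ 2, 0⟩ := by
  ext
  · simp [variableChange_a₁]
  · simp only [variableChange_a₂, Units.val_inv_eq_inv_val, Units.val_mk0]
    field_simp
    ring
  · simp [variableChange_a₃]
  · simp only [variableChange_a₄, Units.val_inv_eq_inv_val, Units.val_mk0]
    field_simp
    ring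
  · simp [variableChange_a₆]

/-- `c₄ = 16(λ² - λ + 1)` for the Legendre equation. Silverman, *AEC*, Prop. III.1.7(b) (proof)
and proof of Prop. VII.5.4(c). [cite: SilvermanAEC2009, Prop. III.1.7 (proof)] -/
theorem legendre_c₄ (la : F) :
    (⟨0, -(1 + la), 0, la, 0⟩ : WeierstrassCurve F).c₄ = 16 * (la ^ 2 - la + 1) := by
  simp only [c₄, b₂, b₄]; ring

/-- `Δ = 16λ²(λ - 1)²` for the Legendre equation. Silverman, *AEC*, Prop. III.1.7 (proof).
[cite: SilvermanAEC2009, Prop. III.1.7 (proof)] -/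
theorem legendre_Δ (la : F) :
    (⟨0, -(1 + la), 0, la, 0⟩ : WeierstrassCurve F).Δ = 16 * la ^ 2 * (la - 1) ^ 2 := by
  simp only [Δ, b₂, b₄, b₆, b₈]; ring

variable {w : Valuation F ℝ≥0}

/-- `|16| = 1` when `|2| = 1`. [folklore] -/
theorem val_sixteen_eq_one (h2 : w (2 : F) = 1) : w (16 : F) = 1 := by
  rw [show (16 : F) = 2 ^ 4 by norm_num, map_pow, h2, one_pow]

/-- **Legendre equation with `λ ≢ 0, 1`: good reduction.** Over a valued field with `|2| = 1`, if
`|λ| = |λ - 1| = 1` then `y² = x(x - 1)(x - λ)` is integral with `|Δ| = |16λ²(λ-1)²| = 1`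
(Silverman, *AEC*, proof of Prop. VII.5.4(c), Case 1 / proof of Prop. VII.5.5).
[cite: SilvermanAEC2009, proof of Prop. VII.5.4(c), Case 1 (PDF p. 176)] -/
theorem isIntegral_legendre_of_val (h2 : w (2 : F) = 1) {la : F} (hla : w la = 1)
    (hla1 : w (la - 1) = 1) :
    (⟨0, -(1 + la), 0, la, 0⟩ : WeierstrassCurve F).IsIntegral w.integer ∧
      w (⟨0, -(1 + la), 0, la, 0⟩ : WeierstrassCurve F).Δ = 1 := by
  refine ⟨isIntegral_integer_of_val_le_one (by simp) ?_ (by simp) hla.le (by simp), ?_⟩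
  · show w (-(1 + la)) ≤ 1
    rw [Valuation.map_neg]
    exact w.map_add_le (le_of_eq w.map_one) hla.le
  · show w (WeierstrassCurve.Δ _) = 1
    rw [legendre_Δ, map_mul, map_mul, map_pow, map_pow, val_sixteen_eq_one h2, hla, hla1]
    norm_num

/-- **Legendre equation with `λ ≡ 0, 1` or `λ ∉ 𝒪`: `|j| > 1`.** Over a valued field with
`|2| = 1`, if not (`|λ| = 1` and `|λ - 1| = 1`) then the elliptic curve `y² = x(x - 1)(x - λ)` has
`|j| > 1` (`j = 2⁸(λ² - λ + 1)³/(λ²(λ - 1)²)`): `|λ| < 1` or `|λ - 1| < 1` gives unit `c₄` and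
non-unit `Δ`; `|λ| > 1` gives `|j| = |λ|²` (Silverman, *AEC*, proof of Prop. VII.5.4(c),
Cases 2–3, and Prop. VII.5.5: potential good reduction iff `j` is integral).
[cite: SilvermanAEC2009, proof of Prop. VII.5.4(c), Cases 2–3 (PDF p. 176) and Prop. VII.5.5] -/
theorem one_lt_val_j_legendre (h2 : w (2 : F) = 1) {la : F}
    [hE : (⟨0, -(1 + la), 0, la, 0⟩ : WeierstrassCurve F).IsElliptic]
    (h : ¬ (w la = 1 ∧ w (la - 1) = 1)) :
    1 < w (⟨0, -(1 + la), 0, la, 0⟩ : WeierstrassCurve F).j := by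
  have h16 := val_sixteen_eq_one h2
  have hΔ0 : (⟨0, -(1 + la), 0, la, 0⟩ : WeierstrassCurve F).Δ ≠ 0 := hE.isUnit.ne_zero
  rw [legendre_Δ] at hΔ0
  have hla0 : la ≠ 0 := by
    rintro rfl; apply hΔ0; ring
  have hla1 : la - 1 ≠ 0 := by
    intro h0; apply hΔ0; rw [h0]; ring
  have hwla0 : 0 < w la := (Valuation.pos_iff _).mpr hla0
  have hwla1 : 0 < w (la - 1) := (Valuation.pos_iff _).mpr hla1
  -- `|j| = |c₄|³ / |Δ|`
  have hj : w (⟨0, -(1 + la), 0, la, 0⟩ : WeierstrassCurve F).j =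
      (w (16 * la ^ 2 * (la - 1) ^ 2))⁻¹ * w (16 * (la ^ 2 - la + 1)) ^ 3 := by
    rw [j, map_mul, map_pow, Units.val_inv_eq_inv_val, map_inv₀, coe_Δ', legendre_Δ, legendre_c₄]
  rw [hj, map_mul, map_mul, map_pow, map_pow, map_mul, h16, one_mul, one_mul]
  rcases lt_trichotomy (w la) 1 with hlt | heq | hgt
  · -- `|λ| < 1`: `|λ - 1| = 1`, `|λ² - λ + 1| = 1`, `|j| = |λ|⁻² > 1`
    have h1 : w (la - 1) = 1 := by rw [Valuation.map_sub_swap, Valuation.map_one_sub_of_lt _ hlt]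
    have hc : w (la ^ 2 - la + 1) = 1 := by
      rw [show la ^ 2 - la + 1 = 1 + la * (la - 1) by ring]
      refine Valuation.map_one_add_of_lt _ ?_
      rw [map_mul, h1, mul_one]; exact hlt
    rw [h1, hc, one_pow, one_pow, mul_one, mul_one, one_lt_inv_iff₀]
    exact ⟨pow_pos hwla0 2, pow_lt_one₀ zero_le hlt two_ne_zero⟩
  · -- `|λ| = 1`: then `|λ - 1| < 1`, `|λ² - λ + 1| = 1`, `|j| = |λ - 1|⁻² > 1`
    have h1 : w (la - 1) < 1 := by
      refine lt_of_le_of_ne ?_ fun h' => h ⟨heq, h'⟩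
      exact Valuation.map_sub_le _ heq.le (le_of_eq w.map_one)
    have hc : w (la ^ 2 - la + 1) = 1 := by
      rw [show la ^ 2 - la + 1 = 1 + (la - 1) * la by ring]
      refine Valuation.map_one_add_of_lt _ ?_
      rw [map_mul, heq, mul_one]; exact h1
    rw [heq, hc, one_pow, one_pow, one_mul, mul_one, one_lt_inv_iff₀]
    exact ⟨pow_pos hwla1 2, pow_lt_one₀ zero_le h1 two_ne_zero⟩
  · -- `|λ| > 1`: `|λ - 1| = |λ|`, `|λ² - λ + 1| = |λ|²`, `|j| = |λ|² > 1`
    have h1 : w (la - 1) = w la := Valuation.map_sub_eq_of_lt_left _ (by rwa [map_one])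
    have hsq : w la < w (la ^ 2) := by
      rw [map_pow, sq]
      exact lt_mul_of_one_lt_left hwla0 hgt
    have hc : w (la ^ 2 - la + 1) = w la ^ 2 := by
      have hsub : w (la ^ 2 - la) = w la ^ 2 := by
        rw [Valuation.map_sub_eq_of_lt_left _ hsq, map_pow]
      rw [Valuation.map_add_eq_of_lt_left _ (by rw [hsub, map_one]; exact one_lt_pow₀ hgt two_ne_zero),
        hsub]
    rw [h1, hc, ← pow_mul]
    have hne : w la ≠ 0 := hwla0.ne'
    rw [show (w la ^ 2 * w la ^ 2)⁻¹ * w la ^ (2 * 3) = w la ^ 2 by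
      field_simp]
    exact one_lt_pow₀ hgt two_ne_zero

end Legendre

end Literature.NumberTheory.EllipticCurves

end
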